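import Literature.Topology.FourManifolds.LatticeFormsVectorOrthogonalComplementDiscriminant
import Literature.Topology.FourManifolds.LatticeFormsStableOrthogonalGroupGlueProjection
import HarnessLib

/-!
# The discriminant form of `h^⊥` for a vector of divisor `1`: `D(h^⊥) = p(H) ⊕ K` with `p(H) ≅ ℤ/(h,h)` generated by
# `[(h', ·)|_{h^⊥}]` and `K ≅ D(L)` orthogonally and `q`-isometrically (Gritsenko–Hulek–Sankaran, *Compositio Math.* 146
# (2010) Example 4.8 `(h_d)^⊥_{L_{2t}} ≅ L_{2t,2d} = 2U ⊕ 2E₈(−1) ⊕ ⟨−2t⟩ ⊕ ⟨−2d⟩` and proof of Prop. 4.12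
# `D(h_d^⊥) = p(H) ⊕ ⟨k̄₃⟩`)

Trunk T-4MAN vocabulary; sequel of `LatticeFormsVectorOrthogonalComplementDiscriminant.lean` (row g42-#5: the membership
criterion `v ∈ ℤh + h^⊥ ⟺ (h,h) ∣ (h,v)`, the index `[L : ℤh ⊕ h^⊥]·div(h) = |(h,h)|`, Lemma 7.2) and
`LatticeFormsStableOrthogonalGroupGlueProjection.lean` (row g42-#3: `p_T(H)` = range of `B.toDiscriminantGroup T`, its order).
Vocabulary: `D(T) = discriminantGroup (B.restrict T)`, `b_T = discriminantBilin`, `q_T = discriminantQuad`, the `ℚ`-valued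
pairing `dualForm` of `T^*`, `π = discriminantGroupMkQ : T^* → D(T)`, `ρ = T.subtype.dualMap : L^* → T^*` (restriction of
functionals). Written for lane `lit-hodgefound` (Track 2 foundations; prover seat `lit-hodgefound-p18`, gen 42, row g42-#6).
THEOREMS ONLY — no definition, no named fact, no instance, no notation.

## Source, verbatim (V. Gritsenko, K. Hulek, G. K. Sankaran, Compositio Math. 146 (2010) 404–434, arXiv numbering §4,
held text `paper:arxiv-0802.2078` pp. 11–12)

"**Example 4.8.** Let `f = 1`. From the Proposition 4.6 it follows that for any `t` and `d` there is only one
`Õ(L_{2t})`-orbit of primitive vectors `h_d` with `div(h_d) = 1`. Moreover `c = 0` and so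
`(h_d)^⊥_{L_{2t}} ≅ L_{2t,2d} = 2U ⊕ 2E₈(−1) ⊕ ⟨−2t⟩ ⊕ ⟨−2d⟩`. **Definition 4.9.** We call a polarisation determined by a
primitive vector `h_d` split if `div(h_d) = 1` and non-split otherwise." And in the proof of Prop. 4.12: "We note that the
orders of `k̄₁` and of `k̄₃` in `D(L_B) = D((h_d)^⊥_{L_{2t}})` are equal to `2d/f` and `2t/f` respectively. Moreover
`k̄₁ · k̄₃ = 0`. […] It follows that `k̄₁` and `k̄₃` form a basis of `D(L_B)` if `w = 1`. […] The subgroup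
`H = L_{2t}/(⟨h_d⟩ ⊕ h_d^⊥) < D(h_d) ⊕ D(L_B)` has order `2d/f`. It is generated by the element `k̄₁ − f h̄_d/2d`. Therefore
the projection `p(H) = p_{h_d^⊥}(H) = ⟨k̄₁⟩` is the subgroup generated by `k̄₁`. It follows if `w = 1` the discriminant
group is `D(h_d^⊥) = ⟨k̄₁⟩ ⊕ ⟨k̄₃⟩ = p(H) ⊕ ⟨k̄₃⟩`."

## What is here: the lattice-free form of the case `f = div(h) = 1` (all proved)

`B` symmetric on a finitely generated free `ℤ`-module `M = L`; `h, h' ∈ L` with `(h, h') = 1` (so `div(h) = 1`, `h` is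
primitive, and `L = h^⊥ ⊕ ℤh'` as a group); `T = h^⊥`; `K ⊂ D(T)` the image of `{ψ ∈ L^* | ψ(h) = 0}` under restriction
(`ψ ↦ [ψ|_T]`), i.e. `K = (L^* ∩ T_ℚ)/T` — for `L = L_{2t}` this is GHS's `⟨k̄₃⟩`, `k₃ = c e₂ + (f/2t) l_t ∈ L^∨ ∩ h^⊥_ℚ`.

* §1 Group structure: `L = h^⊥ ⊕ ℤh'` (`isCompl_orthogonal_span_singleton_of_apply_eq_one`); `p(H)` is cyclic, generated
  by `[(h', ·)|_T]` (`range_toDiscriminantGroup_eq_span_of_apply_eq_one`); **`D(T) = p(H) ⊕ K`**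
  (`range_toDiscriminantGroup_sup_eq_top_of_apply_eq_one`, `range_toDiscriminantGroup_inf_eq_bot_of_apply_eq_one`,
  `isCompl_range_toDiscriminantGroup_of_apply_eq_one`); the restriction map **`Φ : D(L) → D(T)`, `[ψ] ↦ [(ψ − ψ(h)·(h', ·))|_T]`,
  is injective with image `K`** (`exists_linearMap_discriminantGroup_injective_range_eq_of_apply_eq_one`), so
  `|K| = |D(L)|` (`natCard_eq_natCard_discriminantGroup_of_apply_eq_one`), and `|p(H)| = |(h,h)|`
  (`natCard_range_toDiscriminantGroup_eq_natAbs_of_apply_eq_one`, `B` nondegenerate).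
* §2 Forms (`B` nondegenerate, `(h,h) ≠ 0`): **`p(H) ⊥ K` for `b_T`** (`discriminantBilin_toDiscriminantGroup_eq_zero_of_apply_eq_zero`:
  `((x,·)|_T . ψ|_T)_{T^*} = ψ(x) ∈ ℤ` when `ψ(h) = 0`); **`q_T ∘ Φ = q_L`** (`discriminantQuad_mk_dualMap_subtype_of_apply_eq_zero`,
  `discriminantQuad_mk_dualMap_subtype_sub_of_apply_eq_one`, for even `L`); and the value on the generator, **`q_T([(h',·)|_T]) = (h',h') − 1/(h,h) mod 2ℤ`**
  (`dualForm_domRestrict₂_self_of_apply_eq_one`, `discriminantQuad_toDiscriminantGroup_of_apply_eq_one`) — for even `L` and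
  `(h,h) = 2d` this is `q_{⟨−2d⟩}` on a generator, i.e. `p(H) ≅ D(⟨−2d⟩)`, the `⟨−2d⟩` of `L_{2t,2d}`.
* Reading notes. GHS obtain the decomposition from the explicit model after moving `h_d` into `U ⊕ ⟨−2t⟩` by Eichler's
  criterion, and for all `f` with `w = 1`; here only `f = 1` (split polarisations, the case of §5–§6 of the paper and of
  `Õ(L_{2,2d})`) but for every lattice and every `h` of divisor `1`, with no model and no parity hypothesis except where `q`
  is mentioned. The general `w = 1` decomposition and the orbit statement of Example 4.8 (in the tree:
  `LatticeFormsPolarisationTypesSplitNonsplit.lean`) are not restated.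

## References

* [GritsenkoHulekSankaran2010Symplectic] V. Gritsenko, K. Hulek, G. K. Sankaran, Moduli spaces of irreducible symplectic
  manifolds, Compositio Math. 146 (2010): §4 Example 4.8, Def. 4.9, proof of Prop. 4.12.
* [GritsenkoHulekSankaran2013ModuliK3] V. Gritsenko, K. Hulek, G. K. Sankaran, Moduli of K3 surfaces and irreducible
  symplectic manifolds, Handbook of Moduli I (2013): §7 Lemma 7.2, Example 7.6 (`(h_{2d})^⊥ ≅ L_{2d}`).
* [Nikulin1980] V. V. Nikulin, Integral symmetric bilinear forms and some of their geometric applications, Math. USSR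
  Izv. 14 (1980): §1.3, §1.5.
-/

noncomputable section

open Module Function
open LinearMap (BilinForm)
open Literature.Topology.FourManifolds

namespace LinearMap.BilinForm

/-! ### §1 `L = h^⊥ ⊕ ℤh'`, `p(H) = ⟨[(h',·)|_{h^⊥}]⟩`, `D(h^⊥) = p(H) ⊕ K`, `K ≅ D(L)` -/

section Group

variable {M : Type*} [AddCommGroup M] (B : BilinForm ℤ M)

/-- **`L = h^⊥ ⊕ ℤh'` when `(h, h') = 1`**: `x = (x − (h,x) h') + (h,x) h'` with `(h, x − (h,x)h') = 0`, and
`ℤh' ∩ h^⊥ = 0`. (`h^⊥ = {y | (h,y) = 0}` is the left orthogonal; no symmetry needed.)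
[cite: GritsenkoHulekSankaran2010Symplectic, §4 proof of Prop. 4.6 ("A primitive vector `h_d` with `(h_d, L_{2t}) = fℤ`"), Example 4.8 (`f = 1`)] -/
theorem isCompl_orthogonal_span_singleton_of_apply_eq_one {h h' : M} (hh' : B h h' = 1) :
    IsCompl (B.orthogonal (ℤ ∙ h)) (ℤ ∙ h') := by
  refine ⟨Submodule.disjoint_def.2 fun x hx hx' ↦ ?_, codisjoint_iff.2 (eq_top_iff.2 fun x _ ↦ ?_)⟩
  · obtain ⟨a, rfl⟩ := Submodule.mem_span_singleton.1 hx'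
    have h1 := (B.mem_orthogonal_span_singleton_iff).1 hx
    rw [map_zsmul, smul_eq_mul, hh', mul_one] at h1
    rw [h1, zero_smul]
  · refine Submodule.mem_sup.2 ⟨x - B h x • h', ?_, B h x • h', Submodule.mem_span_singleton.2 ⟨B h x, rfl⟩,
      sub_add_cancel x _⟩
    rw [B.mem_orthogonal_span_singleton_iff, map_sub, map_zsmul, smul_eq_mul, hh', mul_one, sub_self]

/-- **`p(H)` is cyclic, generated by `[(h', ·)|_{h^⊥}]`** when `(h, h') = 1`: `x = t + (h,x) h'` with `t ∈ h^⊥ ⊂ ker p`, so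
`p(x) = (h,x) · p(h')` ("`H` … is generated by the element `k̄₁ − f h̄_d/2d`. Therefore the projection `p(H) = ⟨k̄₁⟩`").
[cite: GritsenkoHulekSankaran2010Symplectic, §4 proof of Prop. 4.12] -/
theorem range_toDiscriminantGroup_eq_span_of_apply_eq_one {h h' : M} (hh' : B h h' = 1) :
    LinearMap.range (B.toDiscriminantGroup (B.orthogonal (ℤ ∙ h))) =
      ℤ ∙ B.toDiscriminantGroup (B.orthogonal (ℤ ∙ h)) h' := by
  refine le_antisymm ?_ (Submodule.span_le.2 (Set.singleton_subset_iff.2 ⟨h', rfl⟩))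
  rintro _ ⟨x, rfl⟩
  have hx : x ∈ B.orthogonal (ℤ ∙ h) ⊔ (ℤ ∙ h') := by
    rw [(B.isCompl_orthogonal_span_singleton_of_apply_eq_one hh').sup_eq_top]
    exact Submodule.mem_top
  obtain ⟨t, ht, s, hs, hts⟩ := Submodule.mem_sup.1 hx
  obtain ⟨a, rfl⟩ := Submodule.mem_span_singleton.1 hs
  rw [← hts, map_add, map_zsmul, LinearMap.mem_ker.1 (B.le_ker_toDiscriminantGroup _ ht), zero_add]
  exact Submodule.smul_mem _ a (Submodule.mem_span_singleton_self _)

variable [Module.Finite ℤ M] [Module.Free ℤ M]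

/-- **`|p(H)| = |(h,h)|`** for `(h, h') = 1`, `(h,h) ≠ 0`, `B` nondegenerate symmetric ("`H` … has order `2d/f`", `f = 1`):
`|p(H)| = [L : ℤh ⊕ h^⊥]` (`p` injective on `H`, `ℤh` primitive) `= |(h,h)|/div(h)`.
[cite: GritsenkoHulekSankaran2010Symplectic, §4 proof of Prop. 4.12] [cite: GritsenkoHulekSankaran2013ModuliK3, §7 proof of Lemma 7.2] -/
theorem natCard_range_toDiscriminantGroup_eq_natAbs_of_apply_eq_one (hBn : B.Nondegenerate) (hB : B.IsSymm)
    {h h' : M} (hh : B h h ≠ 0) (hh' : B h h' = 1) :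
    Nat.card (LinearMap.range (B.toDiscriminantGroup (B.orthogonal (ℤ ∙ h)))) = (B h h).natAbs := by
  rw [B.natCard_range_toDiscriminantGroup_orthogonal_eq_index hB (ℤ ∙ h)
    (fun k w hk hw ↦ mem_span_singleton_of_smul_mem_of_apply_eq_one hh' hk hw) (B.nondegenerate_restrict_span_singleton hh)
    (B.nondegenerate_restrict_orthogonal_span_singleton hBn hB hh),
    ← B.index_span_singleton_sup_orthogonal_mul_eq_natAbs hh (δ := 1) (fun z ↦ by rw [Nat.cast_one]; exact one_dvd _)
      (by rw [hh', Nat.cast_one]), mul_one]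

omit [Module.Free ℤ M] in
/-- **`D(h^⊥) = p(H) + K`**: every functional `φ` on the primitive `T = h^⊥` is `ψ|_T` for some `ψ ∈ L^*`, and
`ψ = (ψ − ψ(h)·(h',·)) + ψ(h)·(h',·)` with `(ψ − ψ(h)(h',·))(h) = 0` (`(h',h) = 1`) and `[(h',·)|_T] = p(h') ∈ p(H)`.
Here `K = π(ρ(ker ev_h))`. [cite: GritsenkoHulekSankaran2010Symplectic, §4 proof of Prop. 4.12 ("`D(h_d^⊥) = ⟨k̄₁⟩ ⊕ ⟨k̄₃⟩ = p(H) ⊕ ⟨k̄₃⟩`")] -/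
theorem range_toDiscriminantGroup_sup_eq_top_of_apply_eq_one (hB : B.IsSymm) {h h' : M} (hh' : B h h' = 1) :
    LinearMap.range (B.toDiscriminantGroup (B.orthogonal (ℤ ∙ h))) ⊔
      (LinearMap.ker (Module.Dual.eval ℤ M h)).map
        ((B.restrict (B.orthogonal (ℤ ∙ h))).discriminantGroupMkQ ∘ₗ (B.orthogonal (ℤ ∙ h)).subtype.dualMap) = ⊤ := by
  refine eq_top_iff.2 fun a _ ↦ ?_
  obtain ⟨φ, rfl⟩ := (B.restrict (B.orthogonal (ℤ ∙ h))).discriminantGroup_mk_surjective a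
  obtain ⟨ψ, hψ⟩ := exists_dual_comp_subtype_eq_of_forall_smul_mem (B.orthogonal (ℤ ∙ h))
    (fun k x hk hx ↦ B.mem_orthogonal_of_smul_mem (ℤ ∙ h) hk hx) φ
  have hh'h : B h' h = 1 := by rw [hB.eq, hh']
  -- `φ = (ψ − ψ(h)(h',·))|_T + ψ(h) · (h',·)|_T`
  have hdec : (Submodule.Quotient.mk φ : (B.restrict (B.orthogonal (ℤ ∙ h))).discriminantGroup) =
      B.toDiscriminantGroup (B.orthogonal (ℤ ∙ h)) (ψ h • h') +
        ((B.restrict (B.orthogonal (ℤ ∙ h))).discriminantGroupMkQ ∘ₗ (B.orthogonal (ℤ ∙ h)).subtype.dualMap)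
          (ψ - ψ h • B h') := by
    rw [toDiscriminantGroup_apply, LinearMap.comp_apply, discriminantGroupMkQ_apply, ← Submodule.Quotient.mk_add]
    congr 1
    refine LinearMap.ext fun u ↦ ?_
    rw [← hψ]
    simp only [LinearMap.add_apply, LinearMap.comp_apply, Submodule.subtype_apply, LinearMap.dualMap_apply,
      LinearMap.domRestrict₂_apply, LinearMap.sub_apply, LinearMap.smul_apply, smul_eq_mul, map_zsmul]
    ring
  rw [hdec]
  refine Submodule.add_mem _ (Submodule.mem_sup_left ⟨ψ h • h', rfl⟩)
    (Submodule.mem_sup_right ⟨ψ - ψ h • B h', ?_, rfl⟩)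
  change (Module.Dual.eval ℤ M h) (ψ - ψ h • B h') = 0
  rw [Module.Dual.eval_apply, LinearMap.sub_apply, LinearMap.smul_apply, smul_eq_mul, hh'h, mul_one, sub_self]

omit [Module.Finite ℤ M] [Module.Free ℤ M] in
/-- **`p(H) ∩ K = 0`**: if `[(x,·)|_T] = [ψ|_T]` with `ψ(h) = 0`, then `(x − y, ·) − ψ` vanishes on `T` for some `y ∈ T`, hence is
a multiple `c·(h,·)` (`L = T ⊕ ℤh'`, `(h,·)|_T = 0`, `(h,h') = 1`); evaluating at `h` gives `(h,h) ∣ (h,x)`, i.e. `x ∈ ℤh + T`,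
on which `p` vanishes. [cite: GritsenkoHulekSankaran2010Symplectic, §4 proof of Prop. 4.12 ("`|⟨k̄₁⟩ ∩ ⟨k̄₃⟩| = w`")] -/
theorem range_toDiscriminantGroup_inf_eq_bot_of_apply_eq_one (hB : B.IsSymm) {h h' : M} (hh' : B h h' = 1) :
    LinearMap.range (B.toDiscriminantGroup (B.orthogonal (ℤ ∙ h))) ⊓
      (LinearMap.ker (Module.Dual.eval ℤ M h)).map
        ((B.restrict (B.orthogonal (ℤ ∙ h))).discriminantGroupMkQ ∘ₗ (B.orthogonal (ℤ ∙ h)).subtype.dualMap) = ⊥ := by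
  refine (Submodule.eq_bot_iff _).2 fun a ha ↦ ?_
  obtain ⟨⟨x, rfl⟩, ⟨ψ, hψ0, hψ⟩⟩ := Submodule.mem_inf.1 ha
  change (Module.Dual.eval ℤ M h) ψ = 0 at hψ0
  rw [Module.Dual.eval_apply] at hψ0
  rw [LinearMap.comp_apply, discriminantGroupMkQ_apply, toDiscriminantGroup_apply] at hψ
  obtain ⟨y, hy⟩ := (Submodule.Quotient.eq _).1 hψ
  -- `lam = ψ − (x + y, ·)` vanishes on `T`; `lam = lam(h') · (h, ·)`
  have hT : ∀ u ∈ B.orthogonal (ℤ ∙ h), ψ u = B (x + y) u := fun u hu ↦ by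
    have h1 := LinearMap.congr_fun hy ⟨u, hu⟩
    rw [LinearMap.sub_apply, LinearMap.dualMap_apply, LinearMap.domRestrict₂_apply] at h1
    change B (y : M) u = ψ u - B x u at h1
    rw [map_add, LinearMap.add_apply, h1]
    ring
  have htop : ∀ v, v ∈ B.orthogonal (ℤ ∙ h) ⊔ (ℤ ∙ h') := fun v ↦ by
    rw [(B.isCompl_orthogonal_span_singleton_of_apply_eq_one hh').sup_eq_top]
    exact Submodule.mem_top
  have hlam : ∀ v, ψ v - B (x + y) v = (ψ h' - B (x + y) h') * B h v := fun v ↦ by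
    obtain ⟨t, ht, s, hs, hts⟩ := Submodule.mem_sup.1 (htop v)
    obtain ⟨a, rfl⟩ := Submodule.mem_span_singleton.1 hs
    rw [← hts, map_add, map_add, hT t ht, map_zsmul, map_zsmul, map_add (B h), map_zsmul,
      (B.mem_orthogonal_span_singleton_iff).1 ht, smul_eq_mul, smul_eq_mul, smul_eq_mul, hh']
    ring
  -- at `v = h`: `−(x + y, h) = c (h, h)`, and `(y, h) = 0`
  have hyh : B (y : M) h = 0 := by rw [hB.eq]; exact (B.mem_orthogonal_span_singleton_iff).1 y.2
  have h2 : B (x + y) h = B h x := by rw [map_add, LinearMap.add_apply, hyh, add_zero, hB.eq x h]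
  have hdvd : B h h ∣ B h x := by
    have h1 := hlam h
    rw [hψ0, zero_sub, h2] at h1
    exact ⟨-(ψ h' - B (x + y) h'), by linear_combination -h1⟩
  have hx : x ∈ (ℤ ∙ h) ⊔ B.orthogonal (ℤ ∙ h) := (B.mem_span_singleton_sup_orthogonal_span_singleton_iff h x).2 hdvd
  obtain ⟨s, hs, t, ht, rfl⟩ := Submodule.mem_sup.1 hx
  obtain ⟨a, rfl⟩ := Submodule.mem_span_singleton.1 hs
  have h0' : B.domRestrict₂ (B.orthogonal (ℤ ∙ h)) h = 0 := LinearMap.ext fun u ↦ by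
    rw [LinearMap.domRestrict₂_apply, LinearMap.zero_apply]
    exact (B.mem_orthogonal_span_singleton_iff).1 u.2
  have h0 : B.toDiscriminantGroup (B.orthogonal (ℤ ∙ h)) h = 0 := by
    rw [toDiscriminantGroup_apply, h0', Submodule.Quotient.mk_zero]
  exact LinearMap.mem_ker.1 (Submodule.add_mem _ (Submodule.smul_mem _ a (LinearMap.mem_ker.2 h0))
    (B.le_ker_toDiscriminantGroup _ ht))

omit [Module.Free ℤ M] in
/-- **`D(h^⊥) = p(H) ⊕ K`** (internal direct sum) for `(h, h') = 1`, `B` symmetric.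
[cite: GritsenkoHulekSankaran2010Symplectic, §4 proof of Prop. 4.12 ("`D(h_d^⊥) = … = p(H) ⊕ ⟨k̄₃⟩`")] -/
theorem isCompl_range_toDiscriminantGroup_of_apply_eq_one (hB : B.IsSymm) {h h' : M} (hh' : B h h' = 1) :
    IsCompl (LinearMap.range (B.toDiscriminantGroup (B.orthogonal (ℤ ∙ h))))
      ((LinearMap.ker (Module.Dual.eval ℤ M h)).map
        ((B.restrict (B.orthogonal (ℤ ∙ h))).discriminantGroupMkQ ∘ₗ (B.orthogonal (ℤ ∙ h)).subtype.dualMap)) :=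
  ⟨disjoint_iff.2 (B.range_toDiscriminantGroup_inf_eq_bot_of_apply_eq_one hB hh'),
    codisjoint_iff.2 (B.range_toDiscriminantGroup_sup_eq_top_of_apply_eq_one hB hh')⟩

omit [Module.Finite ℤ M] [Module.Free ℤ M] in
/-- **`K ≅ D(L)`: the map `Φ : D(L) → D(h^⊥)`, `[ψ] ↦ [(ψ − ψ(h)(h',·))|_{h^⊥}]`, is well defined, injective, with image `K`**
(`(h,h') = 1`, `B` symmetric): `(y,·) ↦ ((y − (h,y)h', ·))|_T` lands in `i_T(T)`; and if `(ψ − ψ(h)(h',·))|_T = (t₀,·)|_T` then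
`ψ − ψ(h)(h',·) − (t₀,·)` vanishes on `T`, so equals `c·(h,·)`, and `ψ ∈ i_L(L)`. ("the orders of `k̄₁` and of `k̄₃` … are
`2d/f` and `2t/f`": `|K| = 2t = |D(L_{2t})|`.) [cite: GritsenkoHulekSankaran2010Symplectic, §4 proof of Prop. 4.12] -/
theorem exists_linearMap_discriminantGroup_injective_range_eq_of_apply_eq_one (hB : B.IsSymm) {h h' : M}
    (hh' : B h h' = 1) :
    ∃ Φ : B.discriminantGroup →ₗ[ℤ] (B.restrict (B.orthogonal (ℤ ∙ h))).discriminantGroup,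
      Injective Φ ∧
      LinearMap.range Φ = (LinearMap.ker (Module.Dual.eval ℤ M h)).map
        ((B.restrict (B.orthogonal (ℤ ∙ h))).discriminantGroupMkQ ∘ₗ (B.orthogonal (ℤ ∙ h)).subtype.dualMap) ∧
      ∀ ψ : Module.Dual ℤ M, Φ (Submodule.Quotient.mk ψ) =
        Submodule.Quotient.mk ((B.orthogonal (ℤ ∙ h)).subtype.dualMap (ψ - ψ h • B h')) := by
  have hh'h : B h' h = 1 := by rw [hB.eq, hh']
  -- `F ψ = (ψ − ψ(h)(h',·))|_T`
  let F : Module.Dual ℤ M →ₗ[ℤ] Module.Dual ℤ (B.orthogonal (ℤ ∙ h)) :=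
    (B.orthogonal (ℤ ∙ h)).subtype.dualMap ∘ₗ (LinearMap.id - (Module.Dual.eval ℤ M h).smulRight (B h'))
  have hF : ∀ ψ, F ψ = (B.orthogonal (ℤ ∙ h)).subtype.dualMap (ψ - ψ h • B h') := fun ψ ↦ by
    simp only [F, LinearMap.comp_apply, LinearMap.sub_apply, LinearMap.id_apply, LinearMap.smulRight_apply,
      Module.Dual.eval_apply]
  -- `(ψ − ψ(h)(h',·))(h) = 0`
  have hF0 : ∀ ψ : Module.Dual ℤ M, (ψ - ψ h • B h') h = 0 := fun ψ ↦ by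
    rw [LinearMap.sub_apply, LinearMap.smul_apply, smul_eq_mul, hh'h, mul_one, sub_self]
  -- `F (y,·) = (y − (h,y)h', ·)|_T` with `y − (h,y)h' ∈ T`
  have hmemT : ∀ y : M, y - B y h • h' ∈ B.orthogonal (ℤ ∙ h) := fun y ↦ by
    rw [B.mem_orthogonal_span_singleton_iff, map_sub, map_zsmul, smul_eq_mul, hh', mul_one, hB.eq, sub_self]
  have hFB : ∀ y : M, F (B y) = B.restrict (B.orthogonal (ℤ ∙ h)) ⟨y - B y h • h', hmemT y⟩ := fun y ↦ by
    rw [hF]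
    refine LinearMap.ext fun u ↦ ?_
    rw [LinearMap.dualMap_apply]
    change B y u - (B y h • B h') u = B (y - B y h • h') u
    rw [LinearMap.smul_apply, smul_eq_mul, map_sub, map_zsmul, LinearMap.sub_apply, LinearMap.smul_apply, smul_eq_mul]
  have hle : LinearMap.range B ≤ LinearMap.ker ((B.restrict (B.orthogonal (ℤ ∙ h))).discriminantGroupMkQ ∘ₗ F) := by
    rintro _ ⟨y, rfl⟩
    rw [LinearMap.mem_ker, LinearMap.comp_apply, hFB, discriminantGroupMkQ_apply, Submodule.Quotient.mk_eq_zero]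
    exact LinearMap.mem_range_self _ _
  -- the induced map on `D(L) = L^*/i_L(L)`, re-typed on the canonical `ℤ`-module structure of the quotient
  let Φ₀ := (LinearMap.range B).liftQ _ hle
  let Φ : B.discriminantGroup →ₗ[ℤ] (B.restrict (B.orthogonal (ℤ ∙ h))).discriminantGroup :=
    Φ₀.toAddMonoidHom.toIntLinearMap
  have hΦ : ∀ ψ : Module.Dual ℤ M, Φ (Submodule.Quotient.mk ψ) =
      Submodule.Quotient.mk ((B.orthogonal (ℤ ∙ h)).subtype.dualMap (ψ - ψ h • B h')) := fun ψ ↦ by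
    change Φ₀ (Submodule.Quotient.mk ψ) = _
    rw [Submodule.liftQ_apply, LinearMap.comp_apply, discriminantGroupMkQ_apply, hF]
  refine ⟨Φ, ?_, ?_, hΦ⟩
  · -- injective
    refine (injective_iff_map_eq_zero Φ).2 fun a ha ↦ ?_
    obtain ⟨ψ, rfl⟩ := B.discriminantGroup_mk_surjective a
    rw [hΦ, Submodule.Quotient.mk_eq_zero] at ha
    obtain ⟨t₀, ht₀⟩ := ha
    -- `lam = ψ − ψ(h)(h',·) − (t₀,·)` vanishes on `T`, hence `lam = lam(h') (h,·)`
    have hT : ∀ u ∈ B.orthogonal (ℤ ∙ h), (ψ - ψ h • B h') u = B (t₀ : M) u := fun u hu ↦ by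
      have h1 := LinearMap.congr_fun ht₀ ⟨u, hu⟩
      rw [LinearMap.dualMap_apply] at h1
      exact h1.symm
    have htop : ∀ v, v ∈ B.orthogonal (ℤ ∙ h) ⊔ (ℤ ∙ h') := fun v ↦ by
      rw [(B.isCompl_orthogonal_span_singleton_of_apply_eq_one hh').sup_eq_top]
      exact Submodule.mem_top
    have hlam : ∀ v, (ψ - ψ h • B h') v - B (t₀ : M) v = ((ψ - ψ h • B h') h' - B (t₀ : M) h') * B h v :=
      fun v ↦ by
      obtain ⟨t, ht, s, hs, hts⟩ := Submodule.mem_sup.1 (htop v)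
      obtain ⟨a, rfl⟩ := Submodule.mem_span_singleton.1 hs
      rw [← hts, map_add, map_add, hT t ht, map_zsmul, map_zsmul, map_add (B h), map_zsmul,
        (B.mem_orthogonal_span_singleton_iff).1 ht, smul_eq_mul, smul_eq_mul, smul_eq_mul, hh']
      ring
    refine (Submodule.Quotient.mk_eq_zero _).2 ⟨ψ h • h' + t₀ + ((ψ - ψ h • B h') h' - B (t₀ : M) h') • h,
      LinearMap.ext fun v ↦ ?_⟩
    have h1 := hlam v
    rw [LinearMap.sub_apply, LinearMap.smul_apply, smul_eq_mul] at h1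
    rw [map_add, map_add, map_zsmul, map_zsmul, LinearMap.add_apply, LinearMap.add_apply, LinearMap.smul_apply,
      LinearMap.smul_apply, smul_eq_mul, smul_eq_mul]
    linear_combination -h1
  · -- range
    apply le_antisymm
    · rintro _ ⟨a, rfl⟩
      obtain ⟨ψ, rfl⟩ := B.discriminantGroup_mk_surjective a
      refine ⟨ψ - ψ h • B h', ?_, ?_⟩
      · change (Module.Dual.eval ℤ M h) (ψ - ψ h • B h') = 0
        rw [Module.Dual.eval_apply, hF0]
      · rw [hΦ, LinearMap.comp_apply, discriminantGroupMkQ_apply]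
    · rintro _ ⟨ψ, hψ0, rfl⟩
      change (Module.Dual.eval ℤ M h) ψ = 0 at hψ0
      rw [Module.Dual.eval_apply] at hψ0
      refine ⟨Submodule.Quotient.mk ψ, ?_⟩
      rw [hΦ, LinearMap.comp_apply, discriminantGroupMkQ_apply, hψ0, zero_smul, sub_zero]

omit [Module.Finite ℤ M] [Module.Free ℤ M] in
/-- **`|K| = |D(L)|`** (`(h,h') = 1`, `B` symmetric): `K` is the isomorphic image of `D(L)` ("the order of `k̄₃` … is `2t/f`").
[cite: GritsenkoHulekSankaran2010Symplectic, §4 proof of Prop. 4.12] -/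
theorem natCard_eq_natCard_discriminantGroup_of_apply_eq_one (hB : B.IsSymm) {h h' : M} (hh' : B h h' = 1) :
    Nat.card ((LinearMap.ker (Module.Dual.eval ℤ M h)).map
        ((B.restrict (B.orthogonal (ℤ ∙ h))).discriminantGroupMkQ ∘ₗ (B.orthogonal (ℤ ∙ h)).subtype.dualMap)) =
      Nat.card B.discriminantGroup := by
  obtain ⟨Φ, hinj, hrange, -⟩ := B.exists_linearMap_discriminantGroup_injective_range_eq_of_apply_eq_one hB hh'
  rw [← hrange]
  exact (Nat.card_congr (LinearEquiv.ofInjective Φ hinj).toEquiv).symm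

end Group

/-! ### §2 The forms: `p(H) ⊥ K`, `q_T|_K ≅ q_L`, `q_T(p(h')) = (h',h') − 1/(h,h)` -/

section Forms

variable {M : Type*} [AddCommGroup M] (B : BilinForm ℤ M)

/-- `(h,h)·x − (h,x)·h ∈ h^⊥`. [cite: GritsenkoHulekSankaran2010Symplectic, §4 proof of Prop. 4.12 (`k₁ = (f/2d) h_d − e₂`)] -/
theorem apply_self_smul_sub_apply_smul_mem_orthogonal (h x : M) : B h h • x - B h x • h ∈ B.orthogonal (ℤ ∙ h) := by
  rw [B.mem_orthogonal_span_singleton_iff, map_sub, map_zsmul, map_zsmul, smul_eq_mul, smul_eq_mul]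
  ring

/-- The denominator relation for `(x,·)|_T ∈ T^*`: `i_T((h,h)x − (h,x)h) = (h,h) · (x,·)|_T` (`T = h^⊥`).
[cite: GritsenkoHulekSankaran2010Symplectic, §4 proof of Prop. 4.12 ("`k₁ = (f/2d) h_d − e₂`", the element of `(h_d^⊥)^∨` of order `2d/f`)] -/
theorem restrict_apply_self_smul_sub_eq (h x : M) :
    B.restrict (B.orthogonal (ℤ ∙ h)) ⟨B h h • x - B h x • h, B.apply_self_smul_sub_apply_smul_mem_orthogonal h x⟩ =
      B h h • B.domRestrict₂ (B.orthogonal (ℤ ∙ h)) x := by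
  refine LinearMap.ext fun u ↦ ?_
  rw [LinearMap.smul_apply, LinearMap.domRestrict₂_apply, smul_eq_mul]
  change B (B h h • x - B h x • h) u = B h h * B x u
  rw [map_sub, map_zsmul, map_zsmul, LinearMap.sub_apply, LinearMap.smul_apply, LinearMap.smul_apply, smul_eq_mul,
    smul_eq_mul, (B.mem_orthogonal_span_singleton_iff).1 u.2, mul_zero, sub_zero]

variable [Module.Finite ℤ M] [Module.Free ℤ M]

/-- **`((x,·)|_T . g)_{T^*} = g((h,h)x − (h,x)h)/(h,h)`**: the `ℚ`-valued pairing of `T^*` against the projection of `x ∈ L`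
(`T = h^⊥`, `(h,h) ≠ 0`, `B` nondegenerate symmetric). [cite: GritsenkoHulekSankaran2010Symplectic, §4 proof of Prop. 4.12 (the computation "`k̄₁ · k̄₃ = 0`")] [cite: Nikulin1980, §1.3] -/
theorem dualForm_domRestrict₂_orthogonal_span_singleton_eq_div (hBn : B.Nondegenerate) (hB : B.IsSymm) {h : M}
    (hh : B h h ≠ 0) (x : M) (g : Module.Dual ℤ (B.orthogonal (ℤ ∙ h))) :
    (B.restrict (B.orthogonal (ℤ ∙ h))).dualForm (B.domRestrict₂ (B.orthogonal (ℤ ∙ h)) x) g =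
      (g ⟨B h h • x - B h x • h, B.apply_self_smul_sub_apply_smul_mem_orthogonal h x⟩ : ℚ) / B h h :=
  dualForm_eq_div_of_apply_eq_smul _ (B.nondegenerate_restrict_orthogonal_span_singleton hBn hB hh) hh
    (B.restrict_apply_self_smul_sub_eq h x) g

/-- **`p(H) ⊥ K`: `b_T([(x,·)|_T], [ψ|_T]) = 0` when `ψ(h) = 0`** — the pairing is `ψ(x) − (h,x)ψ(h)/(h,h) = ψ(x) ∈ ℤ`
("Moreover `k̄₁ · k̄₃ = 0`"; `T = h^⊥`, `(h,h) ≠ 0`, `B` nondegenerate symmetric).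
[cite: GritsenkoHulekSankaran2010Symplectic, §4 proof of Prop. 4.12] -/
theorem discriminantBilin_toDiscriminantGroup_eq_zero_of_apply_eq_zero (hBn : B.Nondegenerate) (hB : B.IsSymm) {h : M}
    (hh : B h h ≠ 0) (x : M) {ψ : Module.Dual ℤ M} (hψ : ψ h = 0) :
    (B.restrict (B.orthogonal (ℤ ∙ h))).discriminantBilin (B.nondegenerate_restrict_orthogonal_span_singleton hBn hB hh)
        (hB.restrict _) (B.toDiscriminantGroup (B.orthogonal (ℤ ∙ h)) x)
        (Submodule.Quotient.mk ((B.orthogonal (ℤ ∙ h)).subtype.dualMap ψ)) = 0 := by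
  rw [toDiscriminantGroup_apply, discriminantBilin_mk_mk, B.dualForm_domRestrict₂_orthogonal_span_singleton_eq_div hBn hB hh,
    LinearMap.dualMap_apply, AddCircle.coe_eq_zero_iff]
  refine ⟨ψ x, ?_⟩
  have hq : (B h h : ℚ) ≠ 0 := by exact_mod_cast hh
  rw [zsmul_eq_mul, mul_one, eq_div_iff hq]
  change (ψ x : ℚ) * B h h = ((ψ (B h h • x - B h x • h) : ℤ) : ℚ)
  rw [map_sub, map_zsmul, map_zsmul, hψ, smul_zero, sub_zero, smul_eq_mul]
  push_cast
  ring

/-- **`q_T ∘ Φ = q_L`**: for `ψ ∈ L^*` with `ψ(h) = 0`, `(ψ|_T . ψ|_T)_{T^*} = (ψ . ψ)_{L^*}` — the vector of `ψ` already lies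
in `T_ℚ` (`i_L(dualLift ψ) = |D(L)|·ψ` and `dualLift ψ ⊥ h`); hence `q_T([ψ|_T]) = q_L([ψ])` for even `L` (`T = h^⊥`,
`(h,h) ≠ 0`, `B` nondegenerate symmetric). With §1: `(K, q_T|_K) ≅ (D(L), q_L)` ("`⟨k̄₃⟩`, `k̄₃² ≡ −f²/2t`": the copy of
`D(L_{2t})`). [cite: GritsenkoHulekSankaran2010Symplectic, §4 proof of Prop. 4.12] [cite: Nikulin1980, §1.3] -/
theorem dualForm_dualMap_subtype_self_of_apply_eq_zero (hBn : B.Nondegenerate) (hB : B.IsSymm) {h : M} (hh : B h h ≠ 0)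
    {ψ : Module.Dual ℤ M} (hψ : ψ h = 0) :
    (B.restrict (B.orthogonal (ℤ ∙ h))).dualForm ((B.orthogonal (ℤ ∙ h)).subtype.dualMap ψ)
        ((B.orthogonal (ℤ ∙ h)).subtype.dualMap ψ) = B.dualForm ψ ψ := by
  have hN : (Nat.card B.discriminantGroup : ℤ) ≠ 0 := by exact_mod_cast natCard_discriminantGroup_ne_zero B hBn
  -- `z₀ = dualLift ψ ∈ T`: `(h, z₀) = (z₀, h) = |D(L)| ψ(h) = 0`
  have hz₀ : B.dualLift ψ ∈ B.orthogonal (ℤ ∙ h) := by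
    rw [B.mem_orthogonal_span_singleton_iff, hB.eq, apply_dualLift B hBn, LinearMap.smul_apply, hψ, smul_zero]
  have hden : B.restrict (B.orthogonal (ℤ ∙ h)) ⟨B.dualLift ψ, hz₀⟩ =
      (Nat.card B.discriminantGroup : ℤ) • (B.orthogonal (ℤ ∙ h)).subtype.dualMap ψ := by
    refine LinearMap.ext fun u ↦ ?_
    rw [LinearMap.smul_apply, LinearMap.dualMap_apply]
    change B (B.dualLift ψ) u = (Nat.card B.discriminantGroup : ℤ) • ψ u
    rw [apply_dualLift B hBn, LinearMap.smul_apply]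
  rw [dualForm_eq_div_of_apply_eq_smul _ (B.nondegenerate_restrict_orthogonal_span_singleton hBn hB hh) hN hden,
    LinearMap.dualMap_apply, dualForm_apply]
  rfl

/-- **`q_T([ψ|_T]) = q_L([ψ])` for `ψ(h) = 0`** (`L` even nondegenerate symmetric, `(h,h) ≠ 0`, `T = h^⊥` with the restricted
form, even by `isEven_restrict`): the restriction map `K ≅ D(L)` of §1 is a `q`-isometry.
[cite: GritsenkoHulekSankaran2010Symplectic, §4 proof of Prop. 4.12] [cite: Nikulin1980, §1.3] -/
theorem discriminantQuad_mk_dualMap_subtype_of_apply_eq_zero (hBn : B.Nondegenerate) (hB : B.IsSymm) (he : B.IsEven)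
    {h : M} (hh : B h h ≠ 0) {ψ : Module.Dual ℤ M} (hψ : ψ h = 0) :
    (B.restrict (B.orthogonal (ℤ ∙ h))).discriminantQuad (B.nondegenerate_restrict_orthogonal_span_singleton hBn hB hh)
        (hB.restrict _) (isEven_restrict he _) (Submodule.Quotient.mk ((B.orthogonal (ℤ ∙ h)).subtype.dualMap ψ)) =
      B.discriminantQuad hBn hB he (Submodule.Quotient.mk ψ) := by
  rw [discriminantQuad_mk, discriminantQuad_mk, B.dualForm_dualMap_subtype_self_of_apply_eq_zero hBn hB hh hψ]

/-- **`q_T(Φ[ψ]) = q_L([ψ])` for every `ψ ∈ L^*`**, `Φ[ψ] = [(ψ − ψ(h)(h',·))|_T]` (`(h,h') = 1`; `L` even nondegenerate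
symmetric, `(h,h) ≠ 0`): `ψ − ψ(h)(h',·) ≡ ψ mod i_L(L)` and the previous theorem.
[cite: GritsenkoHulekSankaran2010Symplectic, §4 proof of Prop. 4.12] -/
theorem discriminantQuad_mk_dualMap_subtype_sub_of_apply_eq_one (hBn : B.Nondegenerate) (hB : B.IsSymm) (he : B.IsEven)
    {h h' : M} (hh : B h h ≠ 0) (hh' : B h h' = 1) (ψ : Module.Dual ℤ M) :
    (B.restrict (B.orthogonal (ℤ ∙ h))).discriminantQuad (B.nondegenerate_restrict_orthogonal_span_singleton hBn hB hh)
        (hB.restrict _) (isEven_restrict he _)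
        (Submodule.Quotient.mk ((B.orthogonal (ℤ ∙ h)).subtype.dualMap (ψ - ψ h • B h'))) =
      B.discriminantQuad hBn hB he (Submodule.Quotient.mk ψ) := by
  have hψ' : (ψ - ψ h • B h') h = 0 := by
    rw [LinearMap.sub_apply, LinearMap.smul_apply, smul_eq_mul, hB.eq, hh', mul_one, sub_self]
  rw [B.discriminantQuad_mk_dualMap_subtype_of_apply_eq_zero hBn hB he hh hψ']
  congr 1
  refine (Submodule.Quotient.eq _).2 ⟨-(ψ h • h'), ?_⟩
  rw [map_neg, map_zsmul]
  abel

/-- **The square of the generator of `p(H)`: `((h',·)|_T . (h',·)|_T)_{T^*} = ((h,h)(h',h') − 1)/(h,h)`** for `(h,h') = 1`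
(`T = h^⊥`, `(h,h) ≠ 0`, `B` nondegenerate symmetric). [cite: GritsenkoHulekSankaran2010Symplectic, §4 proof of Prop. 4.12 (`k₁ = (f/2d)h_d − e₂`, so `k₁² = −f²/2d` as `e₂² = 0`, `(h_d, e₂) = f`; here `f = 1`, `h' = e₂`
gives `−1/(h,h)`)] -/
theorem dualForm_domRestrict₂_self_of_apply_eq_one (hBn : B.Nondegenerate) (hB : B.IsSymm) {h h' : M} (hh : B h h ≠ 0)
    (hh' : B h h' = 1) :
    (B.restrict (B.orthogonal (ℤ ∙ h))).dualForm (B.domRestrict₂ (B.orthogonal (ℤ ∙ h)) h')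
        (B.domRestrict₂ (B.orthogonal (ℤ ∙ h)) h') = ((B h h * B h' h' - 1 : ℤ) : ℚ) / B h h := by
  rw [B.dualForm_domRestrict₂_orthogonal_span_singleton_eq_div hBn hB hh, LinearMap.domRestrict₂_apply]
  congr 1
  change ((B h' (B h h • h' - B h h' • h) : ℤ) : ℚ) = _
  rw [map_sub, map_zsmul, map_zsmul, smul_eq_mul, smul_eq_mul, hh', hB.eq h' h, hh']
  push_cast
  ring

/-- **`q_T(p(h')) = (h',h') − 1/(h,h) mod 2ℤ`** for `(h,h') = 1` and even `L` (`(h,h) = 2d ≠ 0`): with `(h',h')` even this is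
`−1/2d mod 2ℤ = q_{⟨−2d⟩}` of a generator — `p(H) ≅ D(⟨−2d⟩)`, the `⟨−2d⟩` of `L_{2t,2d} ≅ (h_d)^⊥`.
[cite: GritsenkoHulekSankaran2010Symplectic, §4 Example 4.8 and proof of Prop. 4.12] -/
theorem discriminantQuad_toDiscriminantGroup_of_apply_eq_one (hBn : B.Nondegenerate) (hB : B.IsSymm) (he : B.IsEven)
    {h h' : M} (hh : B h h ≠ 0) (hh' : B h h' = 1) :
    (B.restrict (B.orthogonal (ℤ ∙ h))).discriminantQuad (B.nondegenerate_restrict_orthogonal_span_singleton hBn hB hh)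
        (hB.restrict _) (isEven_restrict he _) (B.toDiscriminantGroup (B.orthogonal (ℤ ∙ h)) h') =
      (((B h h * B h' h' - 1 : ℤ) : ℚ) / B h h : ℚ) := by
  rw [toDiscriminantGroup_apply, discriminantQuad_mk, B.dualForm_domRestrict₂_self_of_apply_eq_one hBn hB hh hh']

end Forms

end LinearMap.BilinForm
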